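import Mathlib
import Summits.ValiantsHypothesis.ValiantsHypothesis.Theorems.BarrierLeverPartitionMinorsHitByVPHiddenStatesPathTableTransfer

/-!
# Route BarrierLever — item `PartitionMinorsHitByVP` (stmt-ValiantsHypothesis-19717), line `hidden-states`:
# THE DUAL-SPACE CRITERION FOR SEVERAL SWAPS (`B ∖ {X_1,…} ∪ {Y_1,…,Y_m}`)

Helper file (`--supports stmt-ValiantsHypothesis-19717`; cell valiant-natproofs, 𝒟-side door (c), registered line
`Cruxes/PartitionMinorsHitByVP/Lines/hidden_states.lean` v8; prover seat val-np-p6 gen 16).  Closes NO item; definition-free.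
The `m`-swap version of `…PathTableTransfer.det_ne_zero_of_dual` (memo HOME/val-np-p6/g16/MEMO-valnp6-g16.md §7/§8, for the SECOND
SHELL and beyond): for a unipotent table `w`, rows `{|S| ≤ k, S ∉ Xs} ∪ {Y l : l < m}` (injective `Y`) and columns all points `|J| ≤ k`,
the exchange matrix is nonsingular as soon as there are `m` functionals `ζ l` on sets (supported on `|R| ≤ k`), each annihilating every
row `S ∉ Xs` with `|S| ≤ k`, whose PAIRING MATRIX `G l l' = Λ_{ζ l}(Y l')` has nonzero determinant (★ `coeffs_eq_zero_of_dual_family`,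
★ `det_ne_zero_of_dual_family`).  `m = 1` is the single-swap criterion.

WHAT THIS IS NOT: no table for a multi-swap class is given here; nothing on crux 14610 or VP ≠ VNP.
-/

set_option linter.dupNamespace false

namespace Summit.ValiantsHypothesis.ValiantsHypothesis.Theorems.BarrierLever.HiddenStates

open Finset

noncomputable section

namespace PathTable

variable {ι : Type} [Fintype ι] [DecidableEq ι]

/-- ★ **The dual-space criterion (coefficient form).** -/
theorem coeffs_eq_zero_of_dual_family (w : ι → ι → ℂ) (pot : ι → ℕ)
    (hw : ∀ a q, w a q ≠ 0 → q = a ∨ pot q < pot a) (hdiag : ∀ a, w a a = 1)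
    (k : ℕ) (Xs : Finset (Finset ι)) {m : ℕ} (Y : Fin m → Finset ι) (hY : Function.Injective Y)
    (ζ : Fin m → Finset ι → ℂ) (hζ : ∀ l R, k < R.card → ζ l R = 0)
    (hA : ∀ l S, S.card ≤ k → S ∉ Xs →
      ∑ φ ∈ Fintype.piFinset (fun a => if a ∈ S then (Finset.univ : Finset ι) else {a}),
        (∏ a ∈ S, w a (φ a)) * ζ l (S.image φ) = 0)
    (hB : (Matrix.of fun l l' : Fin m =>
      ∑ φ ∈ Fintype.piFinset (fun a => if a ∈ Y l' then (Finset.univ : Finset ι) else {a}),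
        (∏ a ∈ Y l', w a (φ a)) * ζ l ((Y l').image φ)).det ≠ 0)
    (v : Finset ι → ℂ) (hv : ∀ S, v S ≠ 0 → (S.card ≤ k ∧ S ∉ Xs) ∨ S ∈ Set.range Y)
    (h0 : ∀ J : Finset ι, J.card ≤ k → ∑ S, v S * ∏ a ∈ S, ∑ q ∈ J, w a q = 0) :
    ∀ S, v S = 0 := by
  classical
  set C : Finset ι → Finset ι → ℂ := fun R S =>
    ∑ φ ∈ Fintype.piFinset (fun a => if a ∈ S then (Finset.univ : Finset ι) else {a}),
      (if S.image φ = R then ∏ a ∈ S, w a (φ a) else 0) with hC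
  set g : Finset ι → ℂ := fun R => ∑ S, v S * C R S with hg
  have hg0 : ∀ R : Finset ι, R.card ≤ k → g R = 0 := by
    apply moebius_zero
    intro J hJ
    calc ∑ R ∈ J.powerset, g R = ∑ S, v S * ∑ R ∈ J.powerset, C R S := by
          rw [Finset.sum_comm]
          exact Finset.sum_congr rfl fun S _ => by rw [Finset.mul_sum]
      _ = ∑ S, v S * ∏ a ∈ S, ∑ q ∈ J, w a q :=
          Finset.sum_congr rfl fun S _ => by rw [mono_eq_sum_powerset]
      _ = 0 := h0 J hJ
  have hΛ : ∀ l S, ∑ R, ζ l R * C R S =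
      ∑ φ ∈ Fintype.piFinset (fun a => if a ∈ S then (Finset.univ : Finset ι) else {a}),
        (∏ a ∈ S, w a (φ a)) * ζ l (S.image φ) := by
    intro l S
    simp only [hC, Finset.mul_sum]
    rw [Finset.sum_comm]
    refine Finset.sum_congr rfl fun φ _ => ?_
    rw [Finset.sum_eq_single (S.image φ)]
    · rw [if_pos rfl, mul_comm]
    · intro R _ hR; rw [if_neg (Ne.symm hR), mul_zero]
    · intro h; exact (h (Finset.mem_univ _)).elim
  -- the new rows: `G · (v ∘ Y) = 0`
  set G : Matrix (Fin m) (Fin m) ℂ := Matrix.of fun l l' : Fin m =>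
      ∑ φ ∈ Fintype.piFinset (fun a => if a ∈ Y l' then (Finset.univ : Finset ι) else {a}),
        (∏ a ∈ Y l', w a (φ a)) * ζ l ((Y l').image φ) with hGdef
  have hY0 : ∀ l', v (Y l') = 0 := by
    have hsys : G.mulVec (fun l' => v (Y l')) = 0 := by
      funext l
      have h1 : ∑ R, ζ l R * g R = 0 := by
        refine Finset.sum_eq_zero fun R _ => ?_
        by_cases hR : R.card ≤ k
        · rw [hg0 R hR, mul_zero]
        · rw [hζ l R (by omega), zero_mul]
      have h2 : ∑ R, ζ l R * g R = ∑ S, v S * ∑ R, ζ l R * C R S := by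
        simp only [hg, Finset.mul_sum]
        rw [Finset.sum_comm]
        exact Finset.sum_congr rfl fun S _ => Finset.sum_congr rfl fun R _ => by ring
      rw [h2] at h1
      -- only the rows `Y l'` contribute
      have h3 : ∑ S, v S * ∑ R, ζ l R * C R S = ∑ S ∈ (Finset.univ : Finset (Fin m)).image Y, v S * ∑ R, ζ l R * C R S := by
        symm
        apply Finset.sum_subset (Finset.subset_univ _)
        intro S _ hS
        by_cases hvS : v S = 0
        · rw [hvS, zero_mul]
        · rcases hv S hvS with ⟨hcard, hX⟩ | ⟨l', hl'⟩
          · rw [hΛ, hA l S hcard hX, mul_zero]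
          · exact (hS (Finset.mem_image.2 ⟨l', Finset.mem_univ _, hl'⟩)).elim
      rw [h3, Finset.sum_image (fun l _ l' _ h => hY h)] at h1
      rw [Pi.zero_apply, ← h1, Matrix.mulVec, dotProduct]
      refine Finset.sum_congr rfl fun l' _ => ?_
      rw [hGdef, Matrix.of_apply, hΛ, mul_comm]
    have hinj : Function.Injective G.mulVec := by
      rw [Matrix.mulVec_injective_iff_isUnit, Matrix.isUnit_iff_isUnit_det, isUnit_iff_ne_zero]
      exact hB
    have := hinj (hsys.trans (Matrix.mulVec_zero G).symm)
    intro l'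
    exact congrFun this l'
  -- unipotence
  by_contra hne
  push Not at hne
  have hT : (Finset.univ.filter fun S : Finset ι => v S ≠ 0).Nonempty := by
    obtain ⟨S, hS⟩ := hne
    exact ⟨S, Finset.mem_filter.2 ⟨Finset.mem_univ _, hS⟩⟩
  obtain ⟨T, hT1, hTmax⟩ :=
    Finset.exists_max_image (Finset.univ.filter fun S : Finset ι => v S ≠ 0) (fun S => ∑ a ∈ S, pot a) hT
  have hvT : v T ≠ 0 := (Finset.mem_filter.1 hT1).2
  have hTk : T.card ≤ k := by
    rcases hv T hvT with ⟨h, -⟩ | ⟨l', hl'⟩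
    · exact h
    · exact absurd (hl' ▸ hY0 l') hvT
  have hgT := hg0 T hTk
  simp only [hg] at hgT
  rw [Finset.sum_eq_single T] at hgT
  · have hCT : C T T = 1 := transfer_diag w pot hw hdiag T
    rw [hCT, mul_one] at hgT
    exact hvT hgT
  · intro S _ hS
    by_cases hvS : v S = 0
    · rw [hvS, zero_mul]
    · have hle := hTmax S (Finset.mem_filter.2 ⟨Finset.mem_univ _, hvS⟩)
      show v S * C T S = 0
      rw [show C T S = 0 from transfer_offdiag w pot hw hS hle, mul_zero]
  · intro h; exact (h (Finset.mem_univ _)).elim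

/-- ★ **The dual-space criterion (determinant form).** -/
theorem det_ne_zero_of_dual_family (w : ι → ι → ℂ) (pot : ι → ℕ)
    (hw : ∀ a q, w a q ≠ 0 → q = a ∨ pot q < pot a) (hdiag : ∀ a, w a a = 1)
    (k : ℕ) (Xs : Finset (Finset ι)) {m : ℕ} (Y : Fin m → Finset ι) (hY : Function.Injective Y)
    (ζ : Fin m → Finset ι → ℂ) (hζ : ∀ l R, k < R.card → ζ l R = 0)
    (hA : ∀ l S, S.card ≤ k → S ∉ Xs →
      ∑ φ ∈ Fintype.piFinset (fun a => if a ∈ S then (Finset.univ : Finset ι) else {a}),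
        (∏ a ∈ S, w a (φ a)) * ζ l (S.image φ) = 0)
    (hB : (Matrix.of fun l l' : Fin m =>
      ∑ φ ∈ Fintype.piFinset (fun a => if a ∈ Y l' then (Finset.univ : Finset ι) else {a}),
        (∏ a ∈ Y l', w a (φ a)) * ζ l ((Y l').image φ)).det ≠ 0)
    {r : ℕ} (rowS colJ : Fin r → Finset ι) (hinj : Function.Injective rowS)
    (hrow : ∀ i, ((rowS i).card ≤ k ∧ rowS i ∉ Xs) ∨ rowS i ∈ Set.range Y)
    (hcol : ∀ J : Finset ι, J.card ≤ k → ∃ kk, colJ kk = J) :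
    (Matrix.of fun i kk : Fin r => ∏ a ∈ rowS i, ∑ q ∈ colJ kk, w a q).det ≠ 0 := by
  classical
  set M : Matrix (Fin r) (Fin r) ℂ := Matrix.of fun i kk : Fin r => ∏ a ∈ rowS i, ∑ q ∈ colJ kk, w a q with hM
  suffices h : Function.Injective M.vecMul by
    have hu : IsUnit M := Matrix.vecMul_injective_iff_isUnit.1 h
    rw [Matrix.isUnit_iff_isUnit_det, isUnit_iff_ne_zero] at hu
    exact hu
  refine (injective_iff_map_eq_zero (Matrix.vecMulLinear M)).2 fun c hc => ?_
  change Matrix.vecMul c M = 0 at hc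
  let v : Finset ι → ℂ := fun S => ∑ i ∈ Finset.univ.filter (fun i => rowS i = S), c i
  have hvS : ∀ i, v (rowS i) = c i := by
    intro i
    have : Finset.univ.filter (fun i' => rowS i' = rowS i) = {i} := by
      ext i'
      simp only [Finset.mem_filter, Finset.mem_univ, true_and, Finset.mem_singleton]
      exact ⟨fun h => hinj h, fun h => by rw [h]⟩
    simp only [v, this, Finset.sum_singleton]
  have hv : ∀ S, v S ≠ 0 → (S.card ≤ k ∧ S ∉ Xs) ∨ S ∈ Set.range Y := by
    intro S hS
    obtain ⟨i, hi, -⟩ := Finset.exists_ne_zero_of_sum_ne_zero hS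
    have hiS : rowS i = S := (Finset.mem_filter.1 hi).2
    rw [← hiS]
    exact hrow i
  have h0 : ∀ J : Finset ι, J.card ≤ k → ∑ S, v S * ∏ a ∈ S, ∑ q ∈ J, w a q = 0 := by
    intro J hJ
    obtain ⟨kk, hkk⟩ := hcol J hJ
    have hck : (Matrix.vecMul c M) kk = 0 := by rw [hc]; rfl
    rw [Matrix.vecMul, dotProduct] at hck
    calc ∑ S, v S * ∏ a ∈ S, ∑ q ∈ J, w a q
        = ∑ S, ∑ i ∈ Finset.univ.filter (fun i => rowS i = S), c i * ∏ a ∈ S, ∑ q ∈ J, w a q :=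
          Finset.sum_congr rfl fun S _ => by simp only [v, Finset.sum_mul]
      _ = ∑ i, c i * ∏ a ∈ rowS i, ∑ q ∈ J, w a q := by
          rw [← Finset.sum_fiberwise_of_maps_to (s := (Finset.univ : Finset (Fin r))) (t := (Finset.univ : Finset (Finset ι)))
            (g := rowS) (fun _ _ => Finset.mem_univ _)]
          refine Finset.sum_congr rfl fun S _ => Finset.sum_congr rfl fun i hi => ?_
          rw [(Finset.mem_filter.1 hi).2]
      _ = ∑ i, c i * M i kk := Finset.sum_congr rfl fun i _ => by rw [hM, Matrix.of_apply, hkk]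
      _ = 0 := hck
  have hzero := coeffs_eq_zero_of_dual_family w pot hw hdiag k Xs Y hY ζ hζ hA hB v hv h0
  funext i
  rw [← hvS i, hzero]
  rfl

end PathTable

end

end Summit.ValiantsHypothesis.ValiantsHypothesis.Theorems.BarrierLever.HiddenStates
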